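import Summits.QuantumFields.YangMills.Theses.ColdStartUniversality
import Summits.QuantumFields.YangMills.Theorems.ColdStartUniversalityColdStartSolutionsExistNoise
import Summits.QuantumFields.YangMills.Theorems.ColdStartUniversalityColdStartSolutionsExistSpanRange
import Summits.QuantumFields.YangMills.Theorems.ColdStartUniversalityColdStartSolutionsExistQuaternion
import Summits.QuantumFields.YangMills.Theorems.ColdStartUniversalityColdStartSolutionsExistTruncated
import Summits.QuantumFields.YangMills.Theorems.ColdStartUniversalityColdStartSolutionsExistAmbientSolution
import Summits.QuantumFields.YangMills.Theorems.ColdStartUniversalityColdStartSolutionsExistTangentReduce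
import Summits.QuantumFields.YangMills.Theorems.ColdStartUniversalityColdStartSolutionsExistTangentSumSq
import Literature.MathematicalPhysics.QuantumLattice.RepLieAlgebraUnitary
import HarnessLib

/-!
# Route `ColdStartUniversality`: support statement S = `ColdStartSolutionsExist` (stmt-QuantumFields-24811)
# — PROVED (line `piwiener`, lead `ym-line-csu-p1`)

S: for every `F`, `γ > 0`, `K` there are a probability space, a flat Brownian driver `W` and a cold-start
strong solution `U` (`U 0 = 1`) of `latticeLangevinDynamics (SU(2), fundamental) ((γ ε_K)⁻¹/2)` on
Bałaban's `K`-th lattice (SZZ arXiv:2204.12737, §3 Lemma 3.2, for the cold start).  Construction: noise space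
`Ω_L = (Edge 3 L × NoiseIdx 2) → (ℝ≥0 → ℝ)`, `P_L = ⊗ preWienerMeasure`, coordinate Brownian motions
(flat: `isFlatBrownian_piWiener`); solve the TAME, TANGENT modification `S̃` of the SZZ system
(`exists_truncatedCoefficients`) in the ambient `M₂(ℂ)^E` by Itô–Picard in quaternion coordinates
(`ambient_exists_of_tame`); tangent Itô systems keep the sum of squares (`tangentSumSq`, the generic
stochastic-calculus statement B1, via `frobenius_preserved_of_tangent'`), so `‖X_e‖_F² = 2` and the
`V`-valued solution is `SU(2)`-valued (`mem_range_fundamentalRep_of_mem_span`); through `ρ` it solves the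
SZZ system itself (`S̃ = SZZ` on `SU(2)^E`).

RECORD-rung R3 plumbing for the route; this is NOT the Yang–Mills mass gap, not Bałaban's continuum limit,
and says nothing about K_A1/K_A2.  No sorry, standard axioms, no new definitions.
-/

set_option autoImplicit false

noncomputable section

namespace Summit.QuantumFields.YangMills.Theorems.ColdStartUniversality

open MeasureTheory ProbabilityTheory Filter Topology
open scoped NNReal ENNReal BigOperators
open Literature.Probability.Process Literature.MathematicalPhysics.QuantumFieldTheory
open Literature.MathematicalPhysics.QuantumLattice (fundamentalRep fundamentalLatticeRep)
open Literature.MathematicalPhysics.QuantumFieldTheory.Balaban1983to89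
open Summit.QuantumFields.YangMills.Theses.ColdStartUniversality (ColdStartSolutionsExist)

/-! ## Composition lemmas -/

section Compose

variable {Ω : Type*} {m : MeasurableSpace Ω} {P : Measure Ω} {𝓕 : Filtration ℝ≥0 m}

/-- Approximating sequences only see the integrand up to a null set of paths. -/
theorem isApproxSeq_congr_ae {Hn : ℕ → SimpleProcess m 𝓕} {H H' : ℝ≥0 → Ω → ℝ}
    (h : ∀ᵐ ω ∂P, ∀ t, H' t ω = H t ω) (hH : SimpleProcess.IsApproxSeq Hn H P) :
    SimpleProcess.IsApproxSeq Hn H' P := by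
  intro t ε hε
  have hset : ∀ n, P {ω | ENNReal.ofReal ε ≤ ∫⁻ s in Set.Icc (0 : ℝ) t,
        ENNReal.ofReal (((Hn n).toProcess s.toNNReal ω - H' s.toNNReal ω) ^ 2)} =
      P {ω | ENNReal.ofReal ε ≤ ∫⁻ s in Set.Icc (0 : ℝ) t,
        ENNReal.ofReal (((Hn n).toProcess s.toNNReal ω - H s.toNNReal ω) ^ 2)} := by
    intro n
    refine measure_congr (Filter.eventuallyEq_set.2 (h.mono fun ω hω => ?_))
    simp only [Set.mem_setOf_eq, hω]
  simp_rw [hset]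
  exact hH t ε hε

/-- **The characterised Itô integral is insensitive to changing the integrand on a null set of paths.** -/
theorem isItoIntegral_congr_ae {H H' B J : ℝ≥0 → Ω → ℝ} (h : ∀ᵐ ω ∂P, ∀ t, H' t ω = H t ω)
    (hJ : IsItoIntegral H B J 𝓕 P) : IsItoIntegral H' B J 𝓕 P := by
  have h' : ∀ᵐ ω ∂P, ∀ t, H t ω = H' t ω := h.mono fun ω hω t => (hω t).symm
  obtain ⟨h0, hc, hM, ⟨Hn, hHn⟩, hucp⟩ := hJ
  exact ⟨h0, hc, hM, ⟨Hn, isApproxSeq_congr_ae h hHn⟩,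
    fun Gn hGn => hucp Gn (isApproxSeq_congr_ae h' hGn)⟩

/-- Complex version. -/
theorem isItoIntegralC_congr_ae {H H' J : ℝ≥0 → Ω → ℂ} {B : ℝ≥0 → Ω → ℝ}
    (h : ∀ᵐ ω ∂P, ∀ t, H' t ω = H t ω) (hJ : IsItoIntegralC H B J 𝓕 P) :
    IsItoIntegralC H' B J 𝓕 P :=
  ⟨isItoIntegral_congr_ae (h.mono fun ω hω t => by rw [hω t]) hJ.1,
    isItoIntegral_congr_ae (h.mono fun ω hω t => by rw [hω t]) hJ.2⟩

end Compose

/-- Measurability into `SU(2)` is measurability of the matrix entries (the Borel σ-algebra of `SU(2)` is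
induced by the entries, tree `measurableSpace_specialUnitaryGroup_eq_comap`). -/
theorem measurable_su2_of_entries {α : Type*} {mα : MeasurableSpace α}
    {f : α → Matrix.specialUnitaryGroup (Fin 2) ℂ}
    (h : Measurable fun a => (fun i j => (f a : Matrix (Fin 2) (Fin 2) ℂ) i j : Fin 2 → Fin 2 → ℂ)) :
    Measurable f := by
  have hm : (Matrix.specialUnitaryGroup.instMeasurableSpace :
      MeasurableSpace (Matrix.specialUnitaryGroup (Fin 2) ℂ)) =
      MeasurableSpace.comap suEntries (inferInstance : MeasurableSpace (Fin 2 → Fin 2 → ℂ)) :=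
    measurableSpace_specialUnitaryGroup_eq_comap
  rw [measurable_iff_comap_le, hm, MeasurableSpace.comap_comp]
  exact h.comap_le

/-- The set of parameters where a matrix-valued map with measurable entries is special unitary is
measurable (`A Aᴴ = 1 ∧ det A = 1` are polynomial identities in the entries). -/
theorem measurableSet_mem_su2 {α : Type*} {mα : MeasurableSpace α} {f : α → Matrix (Fin 2) (Fin 2) ℂ}
    (h : Measurable fun a => (fun i j => f a i j : Fin 2 → Fin 2 → ℂ)) :
    MeasurableSet {a | f a ∈ Matrix.specialUnitaryGroup (Fin 2) ℂ} := by
  have hij : ∀ i j, Measurable fun a => f a i j := fun i j =>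
    (measurable_pi_apply j).comp ((measurable_pi_apply i).comp h)
  have hset : {a | f a ∈ Matrix.specialUnitaryGroup (Fin 2) ℂ} =
      (⋂ i : Fin 2, ⋂ j : Fin 2, {a | (f a * star (f a)) i j = (1 : Matrix (Fin 2) (Fin 2) ℂ) i j}) ∩
        {a | (f a).det = 1} := by
    ext a
    simp only [Set.mem_setOf_eq, Matrix.mem_specialUnitaryGroup_iff, Matrix.mem_unitaryGroup_iff,
      Set.mem_inter_iff, Set.mem_iInter, ← Matrix.ext_iff]
  rw [hset]
  refine (MeasurableSet.iInter fun i => MeasurableSet.iInter fun j =>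
    measurableSet_eq_fun ?_ measurable_const).inter (measurableSet_eq_fun ?_ measurable_const)
  · simp only [Matrix.mul_apply, Matrix.star_apply]
    exact Finset.measurable_sum _ fun k _ => (hij i k).mul (continuous_star.measurable.comp (hij j k))
  · simp only [Matrix.det_fin_two]
    exact ((hij 0 0).mul (hij 1 1)).sub ((hij 0 1).mul (hij 1 0))


/-! ## The cold-start solution on the product Wiener space -/

/-- **Cold-start strong existence on the product Wiener space.**  Solve the tame tangent modification `S̃`
of the SZZ system from `Q₀ ≡ 1`; the solution stays in the quaternion plane and keeps `‖X_e‖_F² = 2`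
(`tangentSumSq`), so a.s. `X_e(t) ∈ SU(2)` for all `t, e`; `U :=` (retraction onto `SU(2)`) `∘ X` is adapted,
a.s. continuous, starts at `1`, and satisfies the Itô equations of the SZZ system through `ρ`. -/
theorem coldStart_solution (L : ℕ) [NeZero L] (β : ℝ)
    (hW : IsFlatBrownian (fun (t : ℝ≥0) (ω : (Edge 3 L × NoiseIdx 2) → (ℝ≥0 → ℝ)) (i : Edge 3 L × NoiseIdx 2) => brownian t (ω i))
      (Measure.pi fun _ : Edge 3 L × NoiseIdx 2 => preWienerMeasure)) :
    ∃ U : ℝ≥0 → ((Edge 3 L × NoiseIdx 2) → (ℝ≥0 → ℝ)) → GaugeConfig 3 L (Matrix.specialUnitaryGroup (Fin 2) ℂ),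
      (∀ ω, U 0 ω = fun _ => 1) ∧
      (latticeLangevinDynamics (fundamentalLatticeRep 2) β).IsSolution (fundamentalRep (Fin 2))
        hW.natFiltration (Measure.pi fun _ : Edge 3 L × NoiseIdx 2 => preWienerMeasure)
        (fun (t : ℝ≥0) (ω : (Edge 3 L × NoiseIdx 2) → (ℝ≥0 → ℝ)) (i : Edge 3 L × NoiseIdx 2) => brownian t (ω i)) U := by
  classical
  haveI := isProbabilityMeasure_piWiener (Edge 3 L × NoiseIdx 2)
  obtain ⟨S, ⟨⟨K, hK⟩, hV⟩, hTan, hAgree⟩ := exists_truncatedCoefficients L β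
  -- the cold start in matrix coordinates
  set Q₀ : MatrixConfig 3 L 2 := fun _ => 1 with hQ₀def
  have hQ₀V : ∀ e, Q₀ e ∈ Submodule.span ℝ (Set.range (fundamentalRep (Fin 2))) := fun _ =>
    one_mem_spanRange (fundamentalLatticeRep 2)
  have hQ₀sph : ∀ e, hsForm 2 (Q₀ e) (Q₀ e) = 2 := fun _ => by
    have h := hsForm_self_rho (fundamentalLatticeRep 2) 1
    rw [map_one] at h
    exact_mod_cast h
  -- stub A: the ambient solution (vector Picard in quaternion coordinates), `V`-valued
  obtain ⟨X, hX, hXV⟩ := ambient_exists_of_tame hW S (fun Q Q' e => (hK Q Q' e).1)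
    (fun Q Q' e n => (hK Q Q' e).2 n) hV Q₀ hQ₀V
  obtain ⟨hXad, hXp, hXc, hX2, hX0, J, hJ, hXeq⟩ := hX
  -- stub B (via B1 `tangentSumSq`): the Frobenius norms are preserved
  have hsph : ∀ᵐ ω ∂(Measure.pi fun _ : Edge 3 L × NoiseIdx 2 => preWienerMeasure), ∀ (t : ℝ≥0) (e : Edge 3 L),
      hsForm 2 (X t ω e) (X t ω e) = hsForm 2 (Q₀ e) (Q₀ e) :=
    frobenius_preserved_of_tangent' tangentSumSq hW S (fun Q Q' e => (hK Q Q' e).1)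
      (fun Q Q' e n => (hK Q Q' e).2 n) (fun Q e => (hTan Q e).1) (fun Q e n => (hTan Q e).2 n) Q₀ hXp hXc
      hX2 hJ hXeq
  -- stub D: a.s. the solution is SU(2)-valued at all times
  have hmem : ∀ᵐ ω ∂(Measure.pi fun _ : Edge 3 L × NoiseIdx 2 => preWienerMeasure), ∀ (t : ℝ≥0) (e : Edge 3 L),
      X t ω e ∈ Matrix.specialUnitaryGroup (Fin 2) ℂ := by
    filter_upwards [hsph] with ω hω t e
    obtain ⟨g, hg⟩ := mem_range_fundamentalRep_of_mem_span (hXV t ω e) (by rw [hω t e, hQ₀sph e])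
    rw [← hg]
    exact g.2
  -- the measurable retraction onto `SU(2)` (identity on `SU(2)`, `1` elsewhere), as a local function
  set toSU2 : Matrix (Fin 2) (Fin 2) ℂ → Matrix.specialUnitaryGroup (Fin 2) ℂ :=
    fun Q => if h : Q ∈ Matrix.specialUnitaryGroup (Fin 2) ℂ then ⟨Q, h⟩ else 1 with htoSU2
  have coe_toSU2_of_mem : ∀ {Q : Matrix (Fin 2) (Fin 2) ℂ}, Q ∈ Matrix.specialUnitaryGroup (Fin 2) ℂ →
      (toSU2 Q : Matrix (Fin 2) (Fin 2) ℂ) = Q := fun {Q} h => by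
    simp only [htoSU2, dif_pos h]
  have toSU2_one : toSU2 1 = 1 := Subtype.ext (coe_toSU2_of_mem (Submonoid.one_mem _))
  have coe_toSU2 : ∀ Q : Matrix (Fin 2) (Fin 2) ℂ, (toSU2 Q : Matrix (Fin 2) (Fin 2) ℂ) =
      if Q ∈ Matrix.specialUnitaryGroup (Fin 2) ℂ then Q else 1 := fun Q => by
    simp only [htoSU2]
    split_ifs <;> rfl
  have measurable_toSU2_comp : ∀ {mα : MeasurableSpace ((Edge 3 L × NoiseIdx 2) → (ℝ≥0 → ℝ))}
      {f : ((Edge 3 L × NoiseIdx 2) → (ℝ≥0 → ℝ)) → Matrix (Fin 2) (Fin 2) ℂ},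
      Measurable[mα] (fun a => (fun i j => f a i j : Fin 2 → Fin 2 → ℂ)) →
      Measurable[mα] fun a => toSU2 (f a) := by
    intro mα f h
    refine measurable_su2_of_entries ?_
    have hfun : (fun a => (fun i j => (toSU2 (f a) : Matrix (Fin 2) (Fin 2) ℂ) i j : Fin 2 → Fin 2 → ℂ)) =
        fun a => if f a ∈ Matrix.specialUnitaryGroup (Fin 2) ℂ then (fun i j => f a i j : Fin 2 → Fin 2 → ℂ)
          else fun i j => (1 : Matrix (Fin 2) (Fin 2) ℂ) i j := by
      funext a
      rw [coe_toSU2]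
      split_ifs <;> rfl
    rw [hfun]
    exact Measurable.ite (measurableSet_mem_su2 h) h measurable_const
  -- the process `U`
  refine ⟨fun t ω e => toSU2 (X t ω e), fun ω => ?_, ?_⟩
  · funext e
    show toSU2 (X 0 ω e) = 1
    rw [hX0 ω]
    exact toSU2_one
  have hcoe : ∀ᵐ ω ∂(Measure.pi fun _ : Edge 3 L × NoiseIdx 2 => preWienerMeasure), ∀ (t : ℝ≥0) (e : Edge 3 L),
      (fundamentalRep (Fin 2)) (toSU2 (X t ω e)) = X t ω e := by
    filter_upwards [hmem] with ω hω t e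
    exact coe_toSU2_of_mem (hω t e)
  refine ⟨fun t => ?_, ?_, ⟨J, fun e n i j => ?_, ?_⟩⟩
  · -- adapted
    letI : MeasurableSpace ((Edge 3 L × NoiseIdx 2) → (ℝ≥0 → ℝ)) := hW.natFiltration t
    exact measurable_pi_lambda _ fun e =>
      measurable_toSU2_comp ((measurable_pi_apply e).comp (hXad t))
  · -- a.s. continuous paths
    filter_upwards [hXc, hmem] with ω hωc hωm
    refine continuous_pi fun e => ?_
    have hval : Continuous fun t => ((toSU2 (X t ω e) : Matrix.specialUnitaryGroup (Fin 2) ℂ) :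
        Matrix (Fin 2) (Fin 2) ℂ) := by
      have : (fun t => ((toSU2 (X t ω e) : Matrix.specialUnitaryGroup (Fin 2) ℂ) :
          Matrix (Fin 2) (Fin 2) ℂ)) = fun t => X t ω e := funext fun t => coe_toSU2_of_mem (hωm t e)
      rw [this]
      exact (continuous_apply e).comp hωc
    exact Topology.IsInducing.subtypeVal.continuous_iff.2 hval
  · -- the Itô integrals: integrands agree a.s. with those of `X`
    refine isItoIntegralC_congr_ae ?_ (hJ e n i j)
    filter_upwards [hcoe] with ω hω t
    have hcfg : matrixConfig (fundamentalRep (Fin 2)) (fun e' => toSU2 (X t ω e')) = X t ω :=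
      funext fun e' => hω t e'
    have h2 := (hAgree (fun e' => toSU2 (X t ω e')) e).2 n
    rw [hcfg] at h2
    -- goal: (⋆).noise (ρ ∘ U t ω) e n i j = S.noise (X t ω) e n i j
    exact (congrFun (congrFun h2 i) j).symm
  · -- the integral equations
    filter_upwards [hXeq, hcoe] with ω hω hωc t e i j
    have hcfg : ∀ s : ℝ≥0, matrixConfig (fundamentalRep (Fin 2)) (fun e' => toSU2 (X s ω e')) = X s ω :=
      fun s => funext fun e' => hωc s e'
    have hdrift : ∀ s : ℝ≥0, (latticeLangevinDynamics (fundamentalLatticeRep 2) β).drift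
        (matrixConfig (fundamentalRep (Fin 2)) (fun e' => toSU2 (X s ω e'))) e i j = S.drift (X s ω) e i j := by
      intro s
      have h1 := (hAgree (fun e' => toSU2 (X s ω e')) e).1
      rw [hcfg] at h1
      exact (congrFun (congrFun h1 i) j).symm
    have hlhs : (fundamentalRep (Fin 2)) (toSU2 (X t ω e)) i j = X t ω e i j :=
      congrFun (congrFun (hωc t e) i) j
    have h0 : (fundamentalRep (Fin 2)) (toSU2 (X 0 ω e)) i j = Q₀ e i j := by
      rw [congrFun (congrFun (hωc 0 e) i) j, hX0 ω]
    have hint : (∫ s in (0 : ℝ)..t, (latticeLangevinDynamics (fundamentalLatticeRep 2) β).drift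
          (matrixConfig (fundamentalRep (Fin 2)) (fun e' => toSU2 (X s.toNNReal ω e'))) e i j) =
        ∫ s in (0 : ℝ)..t, S.drift (X s.toNNReal ω) e i j :=
      intervalIntegral.integral_congr fun s _ => hdrift s.toNNReal
    calc (fundamentalRep (Fin 2)) (toSU2 (X t ω e)) i j = X t ω e i j := hlhs
      _ = Q₀ e i j + (∫ s in (0 : ℝ)..t, S.drift (X s.toNNReal ω) e i j) + ∑ n, J e n i j t ω :=
          hω t e i j
      _ = (fundamentalRep (Fin 2)) (toSU2 (X 0 ω e)) i j +
            (∫ s in (0 : ℝ)..t, (latticeLangevinDynamics (fundamentalLatticeRep 2) β).drift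
              (matrixConfig (fundamentalRep (Fin 2)) (fun e' => toSU2 (X s.toNNReal ω e'))) e i j) +
            ∑ n, J e n i j t ω := by rw [h0, hint]


/-- **S holds**: the product Wiener space over the links of Bałaban's `K`-th lattice, its coordinate flat
Brownian driver, and the cold-start solution of `coldStart_solution` (`L := N_K`, `β := (γ ε_K)⁻¹/2`). -/
theorem coldStartSolutionsExist_holds : ColdStartSolutionsExist := by
  intro F γ K _hγ
  haveI := isProbabilityMeasure_piWiener (Edge 3 ((F.P K).sitesPerDir 0) × NoiseIdx 2)
  obtain ⟨U, hU0, hsol⟩ := coldStart_solution ((F.P K).sitesPerDir 0) ((γ * (F.P K).eps)⁻¹ / 2)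
    (isFlatBrownian_piWiener 3 _ (NoiseIdx 2))
  exact ⟨_, inferInstance, _, inferInstance, _, isFlatBrownian_piWiener 3 _ (NoiseIdx 2), U, hU0, hsol⟩

end Summit.QuantumFields.YangMills.Theorems.ColdStartUniversality

/-- **Support statement S of route `ColdStartUniversality` (stmt-QuantumFields-24811), by name.**  Cold-start
strong solutions of the SZZ lattice Yang–Mills Langevin dynamics exist on every Bałaban lattice
(RECORD-rung plumbing; not the mass gap). -/
theorem Summit.QuantumFields.YangMills.Theorems.ColdStartSolutionsExist_proof :
    Summit.QuantumFields.YangMills.Theses.ColdStartUniversality.ColdStartSolutionsExist :=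
  Summit.QuantumFields.YangMills.Theorems.ColdStartUniversality.coldStartSolutionsExist_holds

end
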